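-- PORT-REPAIR carch-1-g56 2026-08-21T20:32Z: blocked 2026-08-21T19:47:04Z behind part 1 (p301846); its replayed scope prelude carried the same macro (line 14) — the RUN-81 source's file-local tactic macro `cplx_ring` (5-line block) DELETED and its 3 use(s) on 3 line(s) INLINED with the per-site pruned tactic (carch-1 g54/g55 rendering, hub 0 warnings); nothing else changed: line 1, imports, docstrings, statements byte-identical to port/staging.
import Summits.HodgeConjecture.HodgeCM.Model.ArchU21Characters_1

/-! PORT of `HodgeCM/Model/ArchU21Characters.lean` (HodgeCMPerL run 81) — part 2: continuation of `Summits.HodgeConjecture.HodgeCM.Model.ArchU21Characters_1` (split at a top-level declaration boundary by port_pkg.py; scope re-opened below; declarations unchanged). -/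

-- port_pkg: scope re-opened for this part (file-level context, then the namespace/section stack open at the cut)
set_option autoImplicit false
noncomputable section
open scoped Matrix
open ComplexConjugate Complex
open Literature.Geometry.ComplexHyperbolic Literature.Geometry.ComplexHyperbolic.BallModel
open Literature.NumberTheory.Automorphic.U21 (K21 matA sclD)
namespace HodgeCM.Model.U21Char
/-- (Ported verbatim from the HodgeCMPerL package; no docstring in the source.) -/
theorem conj_det_mul_self (A : Matrix.unitaryGroup (Fin 2) ℂ) :
    conj (A : Matrix (Fin 2) (Fin 2) ℂ).det * (A : Matrix (Fin 2) (Fin 2) ℂ).det = 1 := by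
  have h := congrArg Matrix.det (Matrix.mem_unitaryGroup_iff'.mp A.2)
  rwa [Matrix.det_mul, Matrix.det_one, Matrix.star_eq_conjTranspose, Matrix.det_conjTranspose] at h

/-- `det : U(2) →* U(1)`. -/
def detU : Matrix.unitaryGroup (Fin 2) ℂ →* unitary ℂ where
  toFun A := unitOf (A : Matrix (Fin 2) (Fin 2) ℂ).det (conj_det_mul_self A)
  map_one' := Subtype.ext (by simp)
  map_mul' A B := Subtype.ext (by simp [Matrix.det_mul])

/-- (Ported verbatim from the HodgeCMPerL package; no docstring in the source.) -/
@[simp] theorem coe_detU (A : Matrix.unitaryGroup (Fin 2) ℂ) : (detU A : ℂ) = (A : Matrix (Fin 2) (Fin 2) ℂ).det := rfl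

/-- `U(1) →* U(2)`, `w ↦ diag(w, 1)`. -/
def diagInl : unitary ℂ →* Matrix.unitaryGroup (Fin 2) ℂ where
  toFun w := diag2U w 1 (conj_mul_self_of_unitary w) (by simp)
  map_one' := Subtype.ext (by
    change !![((1 : unitary ℂ) : ℂ), 0; 0, 1] = (1 : Matrix (Fin 2) (Fin 2) ℂ)
    ext i j; fin_cases i <;> fin_cases j <;> simp)
  map_mul' w w' := Subtype.ext (by
    change !![((w * w' : unitary ℂ) : ℂ), 0; 0, 1] = !![(w : ℂ), 0; 0, 1] * !![(w' : ℂ), 0; 0, 1]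
    ext i j; fin_cases i <;> fin_cases j <;> simp [Matrix.mul_apply, Fin.sum_univ_two])

/-- (Ported verbatim from the HodgeCMPerL package; no docstring in the source.) -/
@[simp] theorem coe_diagInl (w : unitary ℂ) : (diagInl w : Matrix (Fin 2) (Fin 2) ℂ) = !![(w : ℂ), 0; 0, 1] := rfl

/-- `U(1) →* U(2) × U(1)`, `w ↦ (diag(w,1), 1)`. -/
def inlK : unitary ℂ →* K21 := (MonoidHom.inl (Matrix.unitaryGroup (Fin 2) ℂ) (unitary ℂ)).comp diagInl

/-- **`D₀ : U(1) →* U(2,1)`, `w ↦ diag(w, 1, 1)`.** -/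
def D₀ : unitary ℂ →* U21 := blockU.comp inlK

/-- (Ported verbatim from the HodgeCMPerL package; no docstring in the source.) -/
theorem mat_D₀ (w : unitary ℂ) : mat (D₀ w) = !![(w : ℂ), 0, 0; 0, 1, 0; 0, 0, 1] := by
  change bmat (matA (inlK w)) (sclD (inlK w)) = _
  ext i j
  fin_cases i <;> fin_cases j <;> simp [bmat, inlK, matA, sclD]

/-- (Ported verbatim from the HodgeCMPerL package; no docstring in the source.) -/
theorem blockU_pair_eq (A : Matrix.unitaryGroup (Fin 2) ℂ) (d : unitary ℂ) :
    blockU (A, d) = blockU (A, 1) * blockU (1, d) := by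
  rw [← map_mul, Prod.mk_mul_mk, mul_one, one_mul]

/-- (Ported verbatim from the HodgeCMPerL package; no docstring in the source.) -/
theorem blockU_inl_mul (A B : Matrix.unitaryGroup (Fin 2) ℂ) :
    blockU (A * B, (1 : unitary ℂ)) = blockU (A, 1) * blockU (B, 1) := by
  rw [← map_mul, Prod.mk_mul_mk, mul_one]

/-- (Ported verbatim from the HodgeCMPerL package; no docstring in the source.) -/
theorem D₀_eq_blockU (w : unitary ℂ) : D₀ w = blockU (diagInl w, 1) := rfl

section KChar

variable {M : Type*} [CommGroup M] (χ : U21 →* M)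

/-- `χ (diag(p, q, 1)) = 1` when `p q = 1`. -/
theorem map_blockU_diag2U (p q : ℂ) (hp : conj p * p = 1) (hq : conj q * q = 1) (hpq : p * q = 1) :
    χ (blockU (diag2U p q hp hq, 1)) = 1 := by
  have e : blockU (diag2U p q hp hq, 1) = torT p hp * torT' q hq := U21_eq_of_mat_eq (by
    rw [mat_mul, mat_blockU, mat_torT, mat_torT']
    have hpq' : conj p * conj q = 1 := by rw [← map_mul, hpq, map_one]
    ext i j
    fin_cases i <;> fin_cases j <;>
      simp [bmat, hypMat, matA, sclD, Matrix.mul_apply, Fin.sum_univ_three, hpq'])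
  rw [e, map_mul, map_torT, map_torT', mul_one]

/-- `χ (diag(1, 1, d)) = χ (diag(d, 1, 1))`. -/
theorem map_blockU_one_left (d : unitary ℂ) : χ (blockU (1, d)) = χ (D₀ d) := by
  have hd : conj ((d : ℂ)) * d = 1 := conj_mul_self_of_unitary d
  have hd' : conj (conj (d : ℂ)) * conj (d : ℂ) = 1 := by rw [conj_conj, mul_comm, hd]
  have e : blockU (1, d) = torT (conj (d : ℂ)) hd' * D₀ d := U21_eq_of_mat_eq (by
    rw [mat_mul, mat_blockU, mat_torT, mat_D₀]
    ext i j
    fin_cases i <;> fin_cases j <;>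
      simp [bmat, hypMat, matA, sclD, Matrix.mul_apply, Fin.sum_univ_three, hd])
  rw [e, map_mul, map_torT, one_mul]

/-- `χ` kills the real rotations `diag(R(x,y), 1)`. -/
theorem map_blockU_rotU (x y : ℝ) (h : x ^ 2 + y ^ 2 = 1) : χ (blockU (rotU x y h, 1)) = 1 := by
  have hC : (x : ℂ) ^ 2 + (y : ℂ) ^ 2 = 1 := by exact_mod_cast h
  have hz : conj ((x : ℂ) + y * I) * ((x : ℂ) + y * I) = 1 := by
    linear_combination (norm := skip) hC
    ((try simp only [map_add, map_mul, Complex.conj_I, Complex.conj_ofReal]); first | ring1 | (ring_nf; simp only [Complex.I_sq]; ring1))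
  have hz' : conj ((x : ℂ) - y * I) * ((x : ℂ) - y * I) = 1 := by
    linear_combination (norm := skip) hC
    ((try simp only [map_sub, map_mul, Complex.conj_I, Complex.conj_ofReal]); first | ring1 | (ring_nf; simp only [Complex.I_sq]; ring1))
  have hzz : ((x : ℂ) + y * I) * ((x : ℂ) - y * I) = 1 := by
    linear_combination (norm := skip) hC
    (first | ring1 | (ring_nf; simp only [Complex.I_sq]; ring1))
  have e := congrArg (fun A => χ (blockU (A, (1 : unitary ℂ)))) (rotU_mul_cayU x y h hz hz')
  simp only [blockU_inl_mul, map_mul] at e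
  rw [map_blockU_diag2U χ _ _ hz hz' hzz, mul_one, mul_comm] at e
  exact mul_left_cancel (e.trans (mul_one _).symm)

/-- `χ` kills `SU(2) × 1`. -/
theorem map_blockU_of_det_eq_one (A : Matrix.unitaryGroup (Fin 2) ℂ) (hA : (A : Matrix (Fin 2) (Fin 2) ℂ).det = 1) :
    χ (blockU (A, 1)) = 1 := by
  have hsu : (A : Matrix (Fin 2) (Fin 2) ℂ) ∈ Matrix.specialUnitaryGroup (Fin 2) ℂ :=
    Matrix.mem_specialUnitaryGroup_iff.mpr ⟨A.2, hA⟩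
  obtain ⟨r00, r10, -, -, hd⟩ := su2_rel hsu
  obtain ⟨a, b, h00, h10⟩ : ∃ a b : ℂ, (A : Matrix (Fin 2) (Fin 2) ℂ) 0 0 = a ∧ (A : Matrix (Fin 2) (Fin 2) ℂ) 1 0 = b :=
    ⟨_, _, rfl, rfl⟩
  rw [h00] at r00 hd
  rw [h10] at r10 hd
  have h01 : (A : Matrix (Fin 2) (Fin 2) ℂ) 0 1 = -conj b := by rw [r10, neg_neg]
  have h11 : (A : Matrix (Fin 2) (Fin 2) ℂ) 1 1 = conj a := r00.symm
  have hn : conj a * a + conj b * b = 1 := by rw [h01, h11] at hd; linear_combination hd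
  have hA_eq : ∀ B : Matrix.unitaryGroup (Fin 2) ℂ, (B : Matrix (Fin 2) (Fin 2) ℂ) = !![a, -conj b; b, conj a] → A = B :=
    fun B hB => Subtype.ext (by
      rw [hB]; ext i j; fin_cases i <;> fin_cases j
      · exact h00
      · exact h01
      · exact h10
      · exact h11)
  by_cases ha : a = 0
  · -- `A = R(0,1) · diag(b, b̄)`
    have hb : conj b * b = 1 := by rw [ha, map_zero, zero_mul, zero_add] at hn; exact hn
    have hb' : conj (conj b) * conj b = 1 := by rw [conj_conj, mul_comm, hb]
    have e : A = rotU 0 1 (by norm_num) * diag2U b (conj b) hb hb' := hA_eq _ (by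
      change (rotU 0 1 _ : Matrix (Fin 2) (Fin 2) ℂ) * (diag2U b (conj b) hb hb' : Matrix (Fin 2) (Fin 2) ℂ) = _
      rw [coe_rotU, coe_diag2U, ha]
      ext i j; fin_cases i <;> fin_cases j <;> simp [Matrix.mul_apply, Fin.sum_univ_two])
    rw [e, blockU_inl_mul, map_mul, map_blockU_rotU, map_blockU_diag2U χ _ _ hb hb' (by rw [mul_comm, hb]), mul_one]
  · -- `A = diag(α, ᾱ) · diag(1, ω) · R(‖a‖, ‖b‖) · diag(1, ω̄)`, `α = a/‖a‖`, `ω = α β`, `β = b/‖b‖` (or `1` if `b = 0`)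
    have hna : (‖a‖ : ℂ) ≠ 0 := by exact_mod_cast (norm_ne_zero_iff.mpr ha)
    have haa : conj a * a = (‖a‖ : ℂ) ^ 2 := Complex.conj_mul' a
    -- the phases of `a` and `b`
    obtain ⟨α, hαa, hα⟩ : ∃ α : ℂ, α * ‖a‖ = a ∧ conj α * α = 1 :=
      ⟨a / ‖a‖, div_mul_cancel₀ a hna, by
        rw [map_div₀, Complex.conj_ofReal, div_mul_div_comm, haa, ← pow_two, div_self (pow_ne_zero 2 hna)]⟩
    obtain ⟨β, hβb, hβ⟩ : ∃ β : ℂ, β * ‖b‖ = b ∧ conj β * β = 1 := by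
      by_cases hb : b = 0
      · exact ⟨1, by rw [hb, norm_zero, Complex.ofReal_zero, mul_zero], by rw [map_one, mul_one]⟩
      · have hnb : (‖b‖ : ℂ) ≠ 0 := by exact_mod_cast (norm_ne_zero_iff.mpr hb)
        have hbb : conj b * b = (‖b‖ : ℂ) ^ 2 := Complex.conj_mul' b
        exact ⟨b / ‖b‖, div_mul_cancel₀ b hnb, by
          rw [map_div₀, Complex.conj_ofReal, div_mul_div_comm, hbb, ← pow_two, div_self (pow_ne_zero 2 hnb)]⟩
    obtain ⟨ω, hω_def⟩ : ∃ ω : ℂ, ω = α * β := ⟨_, rfl⟩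
    have hα' : conj (conj α) * conj α = 1 := by rw [conj_conj, mul_comm, hα]
    have hα2 : α * conj α = 1 := by rw [mul_comm, hα]
    have hω : conj ω * ω = 1 := by rw [hω_def, map_mul, mul_mul_mul_comm, hα, hβ, mul_one]
    have hω' : conj (conj ω) * conj ω = 1 := by rw [conj_conj, mul_comm, hω]
    have hω2 : ω * conj ω = 1 := by rw [mul_comm, hω]
    have hcω : conj ω = conj α * conj β := by rw [hω_def, map_mul]
    have hαa' : conj α * ‖a‖ = conj a := by
      have h := congrArg conj hαa; rwa [map_mul, Complex.conj_ofReal] at h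
    have hβb' : conj β * ‖b‖ = conj b := by
      have h := congrArg conj hβb; rwa [map_mul, Complex.conj_ofReal] at h
    have h1 : conj (1 : ℂ) * 1 = 1 := by rw [map_one, mul_one]
    have hxy : ‖a‖ ^ 2 + ‖b‖ ^ 2 = 1 := by
      have : ((‖a‖ ^ 2 + ‖b‖ ^ 2 : ℝ) : ℂ) = 1 := by
        push_cast
        rw [← haa, ← Complex.conj_mul', hn]
      exact_mod_cast this
    have e : A = diag2U α (conj α) hα hα' * diag2U 1 ω h1 hω * rotU ‖a‖ ‖b‖ hxy * diag2U 1 (conj ω) h1 hω' :=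
      hA_eq _ (by
        change (diag2U α (conj α) hα hα' : Matrix (Fin 2) (Fin 2) ℂ) * (diag2U 1 ω h1 hω : Matrix (Fin 2) (Fin 2) ℂ) *
            (rotU ‖a‖ ‖b‖ hxy : Matrix (Fin 2) (Fin 2) ℂ) * (diag2U 1 (conj ω) h1 hω' : Matrix (Fin 2) (Fin 2) ℂ) = _
        rw [coe_diag2U, coe_diag2U, coe_rotU, coe_diag2U]
        ext i j
        fin_cases i <;> fin_cases j <;> simp [Matrix.mul_apply, Fin.sum_univ_two]
        · linear_combination hαa
        · linear_combination (α * (‖b‖ : ℂ)) * hcω + ((‖b‖ : ℂ) * conj β) * hα2 + hβb'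
        · linear_combination (conj α * (‖b‖ : ℂ)) * hω_def + (β * (‖b‖ : ℂ)) * hα + hβb
        · linear_combination (conj α * (‖a‖ : ℂ)) * hω2 + hαa')
    have hcancel : diag2U 1 ω h1 hω * diag2U 1 (conj ω) h1 hω' = 1 := Subtype.ext (by
      change (diag2U 1 ω h1 hω : Matrix (Fin 2) (Fin 2) ℂ) * (diag2U 1 (conj ω) h1 hω' : Matrix (Fin 2) (Fin 2) ℂ) = 1
      rw [coe_diag2U, coe_diag2U]
      ext i j; fin_cases i <;> fin_cases j <;> simp [Matrix.mul_apply, Fin.sum_univ_two, hω2])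
    rw [e, blockU_inl_mul, blockU_inl_mul, blockU_inl_mul, map_mul, map_mul, map_mul, map_blockU_rotU, mul_one,
      map_blockU_diag2U χ _ _ hα hα' hα2, one_mul, ← map_mul, ← blockU_inl_mul, hcancel]
    have : blockU ((1 : Matrix.unitaryGroup (Fin 2) ℂ), (1 : unitary ℂ)) = 1 := map_one blockU
    rw [this, map_one]

/-- on `U(2) × 1`: `χ (diag(A, 1)) = χ (diag(det A, 1, 1))`. -/
theorem map_blockU_inl (A : Matrix.unitaryGroup (Fin 2) ℂ) : χ (blockU (A, 1)) = χ (D₀ (detU A)) := by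
  -- `A = diag(det A, 1) · (diag(conj (det A), 1) · A)`, the second factor in `SU(2)`
  have hc : conj (conj ((detU A : unitary ℂ) : ℂ)) * conj ((detU A : unitary ℂ) : ℂ) = 1 := by
    rw [conj_conj, mul_comm]; exact conj_mul_self_of_unitary _
  have hww' : detU A * unitOf _ hc = 1 := Subtype.ext (by
    change ((detU A : unitary ℂ) : ℂ) * conj ((detU A : unitary ℂ) : ℂ) = 1
    rw [mul_comm]; exact conj_mul_self_of_unitary _)
  have hdet : ((diagInl (unitOf _ hc) * A : Matrix.unitaryGroup (Fin 2) ℂ) : Matrix (Fin 2) (Fin 2) ℂ).det = 1 := by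
    change ((diagInl (unitOf _ hc) : Matrix (Fin 2) (Fin 2) ℂ) * (A : Matrix (Fin 2) (Fin 2) ℂ)).det = 1
    rw [Matrix.det_mul, coe_diagInl, Matrix.det_fin_two_of, coe_unitOf, coe_detU, mul_one, mul_zero, sub_zero]
    exact conj_det_mul_self A
  have e : A = diagInl (detU A) * (diagInl (unitOf _ hc) * A) := by
    rw [← mul_assoc, ← map_mul, hww', map_one, one_mul]
  calc χ (blockU (A, 1)) = χ (blockU (diagInl (detU A) * (diagInl (unitOf _ hc) * A), 1)) := by rw [← e]
    _ = χ (blockU (diagInl (detU A), 1)) * χ (blockU (diagInl (unitOf _ hc) * A, 1)) := by rw [blockU_inl_mul, map_mul]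
    _ = χ (D₀ (detU A)) := by rw [map_blockU_of_det_eq_one χ _ hdet, mul_one, D₀_eq_blockU]

/-- **On `K = U(2) × U(1)` every homomorphism from `U(2,1)` to a commutative group is a function of `det`:**
`χ (diag(A, d)) = χ (diag(det A · d, 1, 1))`. -/
theorem map_blockU_eq (k : K21) : χ (blockU k) = χ (D₀ (detU k.1 * k.2)) := by
  obtain ⟨A, d⟩ := k
  rw [blockU_pair_eq, map_mul, map_blockU_inl, map_blockU_one_left, ← map_mul, ← map_mul]

end KChar

/-! ## § 6 With continuity: the exponent `ℓ` -/

/-- the unit circle as a subgroup of `unitary ℂ`. -/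
def circleToUnitary : Circle →* unitary ℂ where
  toFun z := ⟨z, Unitary.mem_iff.mpr ⟨by
    rw [Complex.star_def, ← Complex.normSq_eq_conj_mul_self, Circle.normSq_coe, Complex.ofReal_one], by
    rw [mul_comm, Complex.star_def, ← Complex.normSq_eq_conj_mul_self, Circle.normSq_coe, Complex.ofReal_one]⟩⟩
  map_one' := Subtype.ext rfl
  map_mul' _ _ := Subtype.ext rfl

/-- (Ported verbatim from the HodgeCMPerL package; no docstring in the source.) -/
@[simp] theorem coe_circleToUnitary (z : Circle) : ((circleToUnitary z : unitary ℂ) : ℂ) = z := rfl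

/-- (Ported verbatim from the HodgeCMPerL package; no docstring in the source.) -/
theorem norm_coe_unitary (w : unitary ℂ) : ‖(w : ℂ)‖ = 1 := by
  have h : conj (w : ℂ) * w = 1 := conj_mul_self_of_unitary w
  have h2 : ‖(w : ℂ)‖ ^ 2 = 1 := by
    have h' := congrArg (fun z : ℂ => ‖z‖) h
    simp only [norm_mul, Complex.norm_conj, norm_one] at h'
    rw [pow_two]; exact h'
  nlinarith [norm_nonneg (w : ℂ)]

/-- the inverse direction on elements. -/
def unitaryToCircle (w : unitary ℂ) : Circle := ⟨w, mem_sphere_zero_iff_norm.mpr (norm_coe_unitary w)⟩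

/-- (Ported verbatim from the HodgeCMPerL package; no docstring in the source.) -/
@[simp] theorem circleToUnitary_unitaryToCircle (w : unitary ℂ) : circleToUnitary (unitaryToCircle w) = w :=
  Subtype.ext rfl

/-- `z ↦ diag(z, 1, 1)` is continuous on the circle. -/
theorem continuous_D₀_circle : Continuous fun z : Circle => D₀ (circleToUnitary z) := by
  rw [isClosedEmbedding_mat.continuous_iff]
  have h : (mat ∘ fun z : Circle => D₀ (circleToUnitary z)) = fun z : Circle => !![(z : ℂ), 0, 0; 0, 1, 0; 0, 0, 1] := by
    funext z
    rw [Function.comp_apply, mat_D₀, coe_circleToUnitary]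
  rw [h]
  refine continuous_matrix fun i j => ?_
  fin_cases i <;> fin_cases j <;> simp <;> first | exact continuous_const | exact continuous_subtype_val

/-- **With continuity along `z ↦ diag(z, 1, 1)`, an abelian character of `U(2,1)` is `(det A · d)^ℓ` on `K`** for ONE integer `ℓ`
([BröckerTomDieck1985, II (8.1)] through the twin `CircleChar.existsUnique_zpow_complex`). -/
theorem exists_zpow_of_continuous (χ : U21 →* ℂˣ)
    (hχ : Continuous fun z : Circle => ((χ (D₀ (circleToUnitary z)) : ℂˣ) : ℂ)) :
    ∃ ℓ : ℤ, ∀ k : K21, ((χ (blockU k) : ℂˣ) : ℂ) = ((matA k).det * sclD k) ^ ℓ := by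
  let f : Circle →* ℂ := (Units.coeHom ℂ).comp ((χ.comp D₀).comp circleToUnitary)
  have hf : Continuous f := hχ
  obtain ⟨n, hn, -⟩ := Literature.RepresentationTheory.CompactGroups.CircleChar.existsUnique_zpow_complex f hf
  refine ⟨n, fun k => ?_⟩
  rw [map_blockU_eq, ← circleToUnitary_unitaryToCircle (detU k.1 * k.2)]
  exact hn (unitaryToCircle (detU k.1 * k.2))

end HodgeCM.Model.U21Char

end
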